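import Summits.HubbardSuperconductivity.HubbardSuperconductivity.Theorems.ThermalWedgeTwSourcedCondensationEngineReduction
import Summits.HubbardSuperconductivity.HubbardSuperconductivity.Theorems.ThermalWedgeTwSourcedCondensationDiscSlackOfCumulantComparison
import Literature.MathematicalPhysics.QuantumLattice.DWaveSourceTorusComplexSourceDisc

/-!
# Cruxes `TwSourcedCondensation` (stmt-HubbardSuperconductivity-1697) and `TwSourcedInertness` (…-1696)
# reduced to ZERO-SOURCE statements: pair-cumulant comparison (K_c) + heat-chord slack (B)

`--supports stmt-HubbardSuperconductivity-1697`; no definition is introduced.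

Line `zero-source-pair-cumulants` of crux `TwSourcedCondensation` (route `ThermalWedge`). With the bridge
`stub_discSlack_of_pairCumulantComparison` ((K_c) ⇒ the two-sided thermal-disc slack (A), p137714) landed,
the engine reduction `twSourcedCondensation_of_engine : (A) → (B) → TwSourcedCondensation` (p99571) and its
sister `twSourcedInertness_of_engine` compose to

* `twSourcedCondensation_of_pairCumulantComparison : (K_c) → (B) → TwSourcedCondensation`,
* `twSourcedInertness_of_pairCumulantComparison  : (K_c) → (B) → TwSourcedInertness`,

where BOTH hypotheses concern the UNSOURCED weakly repulsive torus only: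

* (K_c) zero-source pair-field cumulant COMPARISON: for `[μ₁,μ₂] ⊂ (-4,0)` `∃ B ∀ η ∃ U₀ a K` such that for
  `0 < U ≤ U₀`, `1 ≤ β ≤ e^{a/U}`, `μ ∈ [μ₁,μ₂]`, eventually in `L`, all `m ≥ 2`,
  `‖(m!)⁻¹[(log Z_L(U,·))⁽ᵐ⁾(0) − (log Z_L(0,·))⁽ᵐ⁾(0)]‖ ≤ (η log β + K)·βL²·(Bβ)^{m−2}`,
  `Z_L(u,z) = tr e^{-β(hubbardTorusWith 2 L 1 u μ − z(Δ_d + Δ_d†))}` — the interaction correction to the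
  `d`-wave–smeared zero-frequency `2m`-leg kernels;
* (B) zero-source heat-chord slack: `∀ η ∃ U₀ a K'`, `[p̃_U(β/2) − p̃_U(β)] − [p̃_0(β/2) − p̃_0(β)] ≤ (η log β + K')/β²`
  on `2 ≤ β ≤ e^{a/U}` — the specific-heat sector.

So NOTHING AT NONZERO SOURCE is needed for either crux: (K_c) ∧ (B) is the free-energy / pair-kernel /
specific-heat output of a one-cutoff (`U log β ≤ a`) multiscale expansion of the zero-source 2D Hubbard torus at
general filling (Benfatto–Giuliani–Mastropietro 2006 §3, there at low density) — the remaining ENGINE of the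
route, NOT asserted here. `pairCumulantComparison_fixedT` records that (K_c) is exactly the β-uniformisation of
a PROVED statement: at fixed `β ≥ 1`, `μ` the comparison holds with `β`-dependent `B, K` and a factor `|U|`
(`dWaveSourceTorus_complexSourceDisc` (iii), single scale).

References: G. Benfatto, A. Giuliani, V. Mastropietro, Ann. Henri Poincaré 7 (2006) 809, Thm 1.1, §3
[BenfattoGiulianiMastropietro2006]; D. Ruelle, *Statistical Mechanics* (1969) §4.4 [Ruelle1969].
-/

noncomputable section

namespace Summit.HubbardSuperconductivity.HubbardSuperconductivity.Theorems

open scoped Nat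
open Matrix Literature.MathematicalPhysics.QuantumLattice
open Summit.HubbardSuperconductivity.HubbardSuperconductivity.Theses.ThermalWedge

/-- **`TwSourcedCondensation` from zero-source data only**: the pair-cumulant comparison (K_c) and the
heat-chord slack (B) of the UNSOURCED torus imply the crux (bridge `stub_discSlack_of_pairCumulantComparison`
into the engine reduction `twSourcedCondensation_of_engine`). The glue for splitting the crux into the two
zero-source children (K_c), (B). [cite: BenfattoGiulianiMastropietro2006, Thm 1.1 and §3] -/
theorem twSourcedCondensation_of_pairCumulantComparison :
    (∀ μ₁ μ₂ : ℝ, -4 < μ₁ → μ₁ ≤ μ₂ → μ₂ < 0 → ∃ B : ℝ, 0 < B ∧ ∀ η : ℝ, 0 < η → ∃ U₀ a K : ℝ, 0 < U₀ ∧ 0 < a ∧ 0 < K ∧ ∀ U : ℝ, 0 < U → U ≤ U₀ → ∀ β : ℝ, 1 ≤ β → β ≤ Real.exp (a / U) → ∀ μ ∈ Set.Icc μ₁ μ₂, ∃ L₀ : ℕ, ∀ (L : ℕ) [NeZero L], L₀ ≤ L → ∀ m : ℕ, 2 ≤ m → ‖((Nat.factorial m : ℂ))⁻¹ * (iteratedDeriv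 m (fun z : ℂ => Complex.log (Matrix.partitionFn β (Literature.MathematicalPhysics.QuantumLattice.hubbardTorusWith 2 L 1 U μ - z • (Literature.MathematicalPhysics.QuantumLattice.pairField Literature.MathematicalPhysics.QuantumLattice.dWaveFormFactor L + (Literature.MathematicalPhysics.QuantumLattice.pairField Literature.MathematicalPhysics.QuantumLattice.dWaveFormFactor L)ᴴ)))) 0 - iteratedDeriv m (fun z : ℂ => Complex.log (Matrix.partitionFn β (Literature.MathematicalPhysics.QuantumLattice.hubbardTorusWith 2 L 1 0 μ - z • (Literature.MathematicalPhysics.QuantumLattice.pairField Literature.MathematicalPhysics.QuantumLattice.dWaveFormFactor L + (Literature.MathematicalPhysics.QuantumLattice.pairField Literature.MathematicalPhysics.QuantumLattice.dWaveFormFactor L)ᴴ)))) 0)‖ ≤ (η * Real.log β + K) * (β * (L : ℝ) ^ 2) * (B * β) ^ (m - 2)) → (∀ μ₁ μ₂ : ℝ, -4 < μ₁ → μ₁ ≤ μ₂ → μ₂ < 0 → ∀ η : ℝ, 0 < η → ∃ U₀ a K' : ℝ, 0 < U₀ ∧ 0 < a ∧ 0 < K' ∧ ∀ U : ℝ, 0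 < U → U ≤ U₀ → ∀ β : ℝ, 2 ≤ β → β ≤ Real.exp (a / U) → ∀ μ ∈ Set.Icc μ₁ μ₂, ∃ L₀ : ℕ, ∀ (L : ℕ) [NeZero L], L₀ ≤ L → (Real.log (Matrix.partitionFn (β / 2) (Literature.MathematicalPhysics.QuantumLattice.dWaveSourceTorus L U μ 0)).re / (β / 2 * (L : ℝ) ^ 2) - Real.log (Matrix.partitionFn β (Literature.MathematicalPhysics.QuantumLattice.dWaveSourceTorus L U μ 0)).re / (β * (L : ℝ) ^ 2)) - (Real.log (Matrix.partitionFn (β / 2) (Literature.MathematicalPhysics.QuantumLattice.dWaveSourceTorus L 0 μ 0)).re / (β / 2 * (L : ℝ) ^ 2) - Real.log (Matrix.partitionFn β (Literature.MathematicalPhysics.QuantumLattice.dWaveSourceTorus L 0 μ 0)).re / (β * (L : ℝ) ^ 2)) ≤ (η * Real.log β + K') / β ^ 2) → Summit.HubbardSuperconductivity.HubbardSuperconductivity.Theses.ThermalWedge.TwSourcedCondensation :=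
  fun hK hB => twSourcedCondensation_of_engine (stub_discSlack_of_pairCumulantComparison hK) hB

/-- **`TwSourcedInertness` (the sister crux, stmt-HubbardSuperconductivity-1696) from the same zero-source
data**: (K_c) and (B) imply it (bridge into `twSourcedInertness_of_engine`).
[cite: BenfattoGiulianiMastropietro2006, Thm 1.1 and §3] -/
theorem twSourcedInertness_of_pairCumulantComparison :
    (∀ μ₁ μ₂ : ℝ, -4 < μ₁ → μ₁ ≤ μ₂ → μ₂ < 0 → ∃ B : ℝ, 0 < B ∧ ∀ η : ℝ, 0 < η → ∃ U₀ a K : ℝ, 0 < U₀ ∧ 0 < a ∧ 0 < K ∧ ∀ U : ℝ, 0 < U → U ≤ U₀ → ∀ β : ℝ, 1 ≤ β → β ≤ Real.exp (a / U) → ∀ μ ∈ Set.Icc μ₁ μ₂, ∃ L₀ : ℕ, ∀ (L : ℕ) [NeZero L], L₀ ≤ L → ∀ m : ℕ, 2 ≤ m → ‖((Nat.factorial m : ℂ))⁻¹ * (iteratedDeriv m (fun z : ℂ => Complex.log (Matrix.partitionFn β (Literature.MathematicalPhysics.QuantumLattice.hubbardTorusWith 2 L 1 U μ - z • (Literature.MathematicalPhysics.QuantumLattice.pairField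 Literature.MathematicalPhysics.QuantumLattice.dWaveFormFactor L + (Literature.MathematicalPhysics.QuantumLattice.pairField Literature.MathematicalPhysics.QuantumLattice.dWaveFormFactor L)ᴴ)))) 0 - iteratedDeriv m (fun z : ℂ => Complex.log (Matrix.partitionFn β (Literature.MathematicalPhysics.QuantumLattice.hubbardTorusWith 2 L 1 0 μ - z • (Literature.MathematicalPhysics.QuantumLattice.pairField Literature.MathematicalPhysics.QuantumLattice.dWaveFormFactor L + (Literature.MathematicalPhysics.QuantumLattice.pairField Literature.MathematicalPhysics.QuantumLattice.dWaveFormFactor L)ᴴ)))) 0)‖ ≤ (η * Real.log β + K) * (β * (L : ℝ) ^ 2) * (B * β) ^ (m - 2)) → (∀ μ₁ μ₂ : ℝ, -4 < μ₁ → μ₁ ≤ μ₂ → μ₂ < 0 → ∀ η : ℝ, 0 < η → ∃ U₀ a K' : ℝ, 0 < U₀ ∧ 0 < a ∧ 0 < K' ∧ ∀ U : ℝ, 0 < U → U ≤ U₀ → ∀ β : ℝ, 2 ≤ β → β ≤ Real.exp (a / U) → ∀ μ ∈ Set.Icc μ₁ μ₂, ∃ L₀ : ℕ, ∀ (L : ℕ)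 [NeZero L], L₀ ≤ L → (Real.log (Matrix.partitionFn (β / 2) (Literature.MathematicalPhysics.QuantumLattice.dWaveSourceTorus L U μ 0)).re / (β / 2 * (L : ℝ) ^ 2) - Real.log (Matrix.partitionFn β (Literature.MathematicalPhysics.QuantumLattice.dWaveSourceTorus L U μ 0)).re / (β * (L : ℝ) ^ 2)) - (Real.log (Matrix.partitionFn (β / 2) (Literature.MathematicalPhysics.QuantumLattice.dWaveSourceTorus L 0 μ 0)).re / (β / 2 * (L : ℝ) ^ 2) - Real.log (Matrix.partitionFn β (Literature.MathematicalPhysics.QuantumLattice.dWaveSourceTorus L 0 μ 0)).re / (β * (L : ℝ) ^ 2)) ≤ (η * Real.log β + K') / β ^ 2) → Summit.HubbardSuperconductivity.HubbardSuperconductivity.Theses.ThermalWedge.TwSourcedInertness :=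
  fun hK hB => twSourcedInertness_of_engine (stub_discSlack_of_pairCumulantComparison hK) hB

/-- **Fixed-temperature calibration of (K_c)** (single scale): for `β ≥ 1`, `μ` there are `U₁, K, B > 0` such
that for all `L ≥ 3`, real `|U| ≤ U₁` and `m ≥ 2` the zero-source pair-cumulant comparison holds in the shape
of (K_c) with an explicit factor `|U|`:
`‖(m!)⁻¹[(log Z_L(U,·))⁽ᵐ⁾(0) − (log Z_L(0,·))⁽ᵐ⁾(0)]‖ ≤ K|U|·βL²·(Bβ)^{m−2}` — item (iii) of
`dWaveSourceTorus_complexSourceDisc` with `B = ϱ/β`, `K = (3/2)(A+1)ϱ³/β`. (K_c) is this statement with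
`U₁ ↦ U₀`, `K|U| ↦ η log β + K` and constants uniform on `1 ≤ β ≤ e^{a/U}` (the multiscale content, NOT
asserted). [cite: Ruelle1969, §4.4] -/
theorem pairCumulantComparison_fixedT {β : ℝ} (hβ : 1 ≤ β) (μ : ℝ) :
    ∃ U₁ K B : ℝ, 0 < U₁ ∧ 0 < K ∧ 0 < B ∧ ∀ (L : ℕ) [NeZero L], 3 ≤ L → ∀ U : ℝ, |U| ≤ U₁ →
      ∀ m : ℕ, 2 ≤ m →
        ‖((Nat.factorial m : ℂ))⁻¹ * (iteratedDeriv m (fun z : ℂ => Complex.log (Matrix.partitionFn β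
            (hubbardTorusWith 2 L 1 U μ - z • (pairField dWaveFormFactor L + (pairField dWaveFormFactor L)ᴴ)))) 0 -
          iteratedDeriv m (fun z : ℂ => Complex.log (Matrix.partitionFn β
            (hubbardTorusWith 2 L 1 0 μ - z • (pairField dWaveFormFactor L + (pairField dWaveFormFactor L)ᴴ)))) 0)‖ ≤
          K * |U| * (β * (L : ℝ) ^ 2) * (B * β) ^ (m - 2) := by
  have hβ0 : 0 < β := by linarith
  obtain ⟨δ, hδ, ϱ, hϱ, -, A, hA, hmain⟩ := dWaveSourceTorus_complexSourceDisc β μ hβ0.le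
  refine ⟨δ, 3 / 2 * (A + 1) * ϱ ^ 3 / β, ϱ / β, hδ, by positivity, by positivity, ?_⟩
  intro L _ hL U hU m hm
  obtain ⟨-, -, hdiff⟩ := hmain L hL U hU
  have key := hdiff m (by omega)
  rw [← mul_sub] at key
  calc _ ≤ 3 / 2 * ((L : ℝ) ^ 2 * A) * ϱ ^ (m + 1) * |U| := key
    _ ≤ 3 / 2 * ((L : ℝ) ^ 2 * (A + 1)) * ϱ ^ (m + 1) * |U| := by gcongr; linarith
    _ = 3 / 2 * (A + 1) * ϱ ^ 3 / β * |U| * (β * (L : ℝ) ^ 2) * (ϱ / β * β) ^ (m - 2) := by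
        have hm2 : m + 1 = (m - 2) + 3 := by omega
        rw [div_mul_cancel₀ ϱ hβ0.ne', hm2, pow_add]
        field_simp

end Summit.HubbardSuperconductivity.HubbardSuperconductivity.Theorems
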